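import Literature.AlgebraicGeometry.AbelianSchemes.AbelianSchemeSmallExtensionIdealCohomology
import Literature.AlgebraicGeometry.Motives.CechH1StructureSheafComparison
import Literature.AlgebraicGeometry.AbelianVarieties.CechH1DimOfCharZeroByTransport
import Literature.AlgebraicGeometry.Deformation.IdealSheafGlobalScalar
import Literature.AlgebraicGeometry.AbelianSchemes.AbelianSchemeOverFibreDim
import Literature.AlgebraicGeometry.Deformation.InvertibleSheafExtensionsFlatSmallExtension
import Literature.AlgebraicGeometry.Deformation.FlatDeformationGlobalFunctions
import Literature.AlgebraicGeometry.Motives.CechClassPushforwardIso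
import Literature.AlgebraicGeometry.Modules.UnitCocyclePresented
import Literature.AlgebraicGeometry.Motives.CechH1ToSheafCohomologySurjective
import Literature.AlgebraicGeometry.Motives.CechH1OfSheafCohomology
import Literature.AlgebraicGeometry.Morphisms.CechH1LengthComparison
import Mathlib.LinearAlgebra.FiniteDimensional.Lemmas
import Mathlib.RingTheory.Artinian.Module
import Mathlib.AlgebraicGeometry.Noetherian
import HarnessLib

/-!
# `H¹(A′_{C′}, 𝓘) ≃ κ^g` compatibly with scalars, for the principal small extension `A′_C ⊂ A′_{C′}` of an abelian scheme
# (the TARGET SPACE of the Kodaira–Spencer count: Mumford, *Abelian Varieties* §13 pp. 126–127; Hartshorne, *Deformation Theory* Thm. 6.4)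

Layer `Literature/AlgebraicGeometry/AbelianSchemes`, namespace `Literature.AlgebraicGeometry.AbelianSchemes.AbelianSchemeOver`.  THEOREMS
ONLY (no definition, no named fact, no instance, no notation, no `sorry`).  Cell `hodgecm-mathlib` (D-0151), F-3 (M) grandchild line
`Cruxes/HDel/Lines/F3DualAbelianSchemeMc`, (N3′) Artinian tower, letter S-e (Kodaira–Spencer SURJECTIVITY at lift level), brick **K4 — the
TARGET-SPACE PANEL** `(E, hdim, hsmul-target)` of B-p07 (g20)'s assembled count `PoincareFamilyKSAssembly.exists_lift_detClassH_eq_add_of_count`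
(§4: «an additive identification `E : H¹(𝓘) ≃+ M` with a `κ`-space of the same dimension as `V`»), with `M := Fin g → κ` so that `hdim` is `rfl`
against the SOURCE panel `V := Fin g → κ` of the infinitesimal points of `Â′` (J6 ∕ F0P1c-p04 (g0)); author F0P1c-p05 (g0), (Mc) lead ruling
B-p02 (g17) #1b 2026-08-30 21:43Z.  HC_CM is proved only modulo the 7 printed citations until rung 0 closes; nothing here is about HC.

SETTING (the letters' carrier, as ★ `AbelianSchemeSmallExtensionPicardTorsor` ∕ S-c1 `AbelianSchemeSmallExtensionIdealCohomology`):
`A′ := A.baseChange p` over the affine `S′`, a principal small extension `q : C′ ↠ C` of local rings (`C′` Artinian, `ker q = (t₀)`, `t₀𝔪 = 0`,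
`t₀ ≠ 0`) with structure map `c′ : Spec C′ → S′`, a residue field `π₀ : C′ ↠ K` (`ker π₀ = 𝔪`), the thickening `i : X = A′_C ↪ X′ = A′_{C′}`
(`(A′.X ◁ ι₀).left`) with ideal `𝓘 = idealSheafAb i`, and the closed fibre `X₀ = A′_K` — an abelian variety over `K` of dimension `g`.

* **`exists_addEquiv_idealCohomology_pi_smallExtension`** — there is an additive isomorphism **`E : H¹(X′, 𝓘) ≃+ (Fin g → K)`** such that for
  every `c ∈ C′` and every endomorphism `μ` of `𝓘` acting sectionwise as multiplication by the global function `c` (`idealVal (μ x) =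
  (f♯c)|_V · idealVal x`; such `μ` exist: ★ `Deformation/IdealSheafGlobalScalar.exists_idealSheafAb_hom_mul`), **`E (H¹(μ) t) = π₀(c) • E t`**.
  Assembly: `E := ℓ ∘ e₂ ∘ e₁⁻¹` with `e₁ : H¹(X₀, 𝒪) ≃+ H¹(X′, 𝓘)` intertwining scalars (S-c1, B-p03 (g20): [Hartshorne2010] §6 (6.1) «`J ⊗_C 𝒪_X
  ≅ 𝒪_{X₀}`, `J` a `k`-vector space»), `e₂ : H¹(X₀, 𝒪) ≃+ Ȟ¹(𝔘, 𝒪_{X₀})` with scalars for a finite affine cover (S-c2, B-p08 (g15): [Hartshorne1977]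
  III 4.5), `dim_K Ȟ¹(𝔘, 𝒪_{X₀}) = dim X₀ = g` ((H1′), B-p07 (g20): [MumfordAV1970] §13 Cor. 2) and a `K`-basis `ℓ : Ȟ¹ ≃ₗ[K] K^g` (Mathlib
  `Module.finBasisOfFinrankEq`); the endomorphism `ν` of `𝒪_{X₀}` matching `μ` is S-c2's `exists_structureSheafAb_hom_mul`.
* `exists_finite_isAffineOpen_cover` — a quasi-compact scheme has a finite affine open cover indexed in `Type` (plumbing).

HONEST SCOPE.  `t₀ ≠ 0` is essential (for `t₀ = 0` the ideal vanishes and `H¹(𝓘) = 0 ≄ K^g` when `g > 0`; the S-e letter is then trivial and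
its closer treats that case apart).  Characteristic `0` enters only through (H1′) (`K` is a `ℚ`-algebra via `ℚ → R → Γ(S′) → C′ → K`).

## References
* [MumfordAV1970] D. Mumford, *Abelian Varieties* (1970), §13, proof of the Theorem pp. 126–127 («both have dimension `g`») and Cor. 2 (p. 129).
* [Hartshorne2010] R. Hartshorne, *Deformation Theory*, GTM 257 (2010), §6 (6.1) pp. 46–47 and Thm. 6.4 (b) with its proof (pp. 50–51).
* [Hartshorne1977] R. Hartshorne, *Algebraic Geometry* (1977), III Thm. 4.5 (p. 222), III Lemma 2.10 (p. 209).
-/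

set_option autoImplicit false

noncomputable section

-- `(X ⊗ T).left = pullback X.hom T.hom` (`Over.tensorObj_left`) and `(A.fibre s).left = pullback A.X.hom s` are `rfl` only at default
-- transparency (as in ★ `AbelianSchemeKOfL`, ★ `SmallExtensionIdealSheaf`).
set_option backward.isDefEq.respectTransparency false

universe u

open CategoryTheory CategoryTheory.Limits AlgebraicGeometry MonoidalCategory Opposite TopologicalSpace

namespace Literature.AlgebraicGeometry.AbelianSchemes

open Literature.AlgebraicGeometry.Motives Literature.AlgebraicGeometry.Modules Literature.AlgebraicGeometry.Deformation
  Literature.AlgebraicGeometry.Morphisms Literature.AlgebraicGeometry.AbelianVarieties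

/-! ## §1 Plumbing: a finite affine open cover; characteristic zero of the residue field; (H1′) on the fibre `A′ ×_{S′} Spec K` -/

/-- A quasi-compact scheme has a FINITE affine open cover indexed by a type in `Type` (Mathlib `isCompact_iff_finite_and_eq_biUnion_affineOpens`
applied to `⊤`; the index type is the finite set of affine opens found).  (Proof as in B-p07 (g20)'s (H1′) file.) [folklore] -/
private theorem exists_finite_isAffineOpen_cover (X : Scheme.{0}) [CompactSpace X] :
    ∃ (ι : Type) (_ : Finite ι) (U : ι → X.Opens), (∀ i, IsAffineOpen (U i)) ∧ iSup U = ⊤ := by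
  obtain ⟨s, hs, e⟩ := (isCompact_iff_finite_and_eq_biUnion_affineOpens (U := (⊤ : X.Opens))).mp
    (by simpa using isCompact_univ)
  haveI := hs.to_subtype
  refine ⟨s, inferInstance, fun i => i.1.1, fun i => i.1.2, ?_⟩
  rw [iSup_subtype]
  exact e.symm

/-- A field receiving a ring homomorphism from a `ℚ`-algebra has characteristic `0`. [folklore] -/
private theorem charZero_of_ringHom_of_algebraRat {R K : Type*} [CommRing R] [Algebra ℚ R] [Field K] (φ : R →+* K) : CharZero K :=
  (RingHom.charZero_iff (φ.comp (algebraMap ℚ R)).injective).mp inferInstance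

namespace AbelianSchemeOver

/-- **(H1′) on the fibre `A′ ×_{S′} Spec K` in the `Over S′`-spelling**: for an abelian scheme `A′ → S′`, a field-valued point `s : Spec K → S′`
with `char K = 0` and a finite affine open cover `𝔘` of `X₀ := (A′.X ⊗ Over.mk s).left = A′ ×_{S′} Spec K`, the `K`-module `Ȟ¹(𝔘, 𝒪_{X₀})`
(structure map `pr₂ : X₀ → Spec K`) is finite of rank `dim (A′_s)` — ★ (H1′) `AbelianVarieties.finrank_cechH1_structureSheaf_eq_dim_of_charZero` (p793005)
([MumfordAV1970] §13 Cor. 2) read on the abelian variety `(A′.fibre s).toAbelianVariety`, whose underlying `K`-scheme IS `pr₂` (definitionally).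
[cite: MumfordAV1970, §13 Cor. 2 (p. 129)] -/
theorem finite_finrank_cechH1_tensor_fibre {S' : Scheme.{0}} (A' : AbelianSchemeOver S') {K : Type} [Field K] [CharZero K]
    (s : Spec (.of K) ⟶ S') {ι : Type} [Finite ι] (U : ι → (A'.X ⊗ Over.mk s).left.Opens) (hU : ∀ i, IsAffineOpen (U i))
    (hUcov : iSup U = ⊤) :
    Module.Finite K (CechH1 (X := (A'.X ⊗ Over.mk s).left) (Limits.pullback.snd A'.X.hom s) U) ∧
      Module.finrank K (CechH1 (X := (A'.X ⊗ Over.mk s).left) (Limits.pullback.snd A'.X.hom s) U) = (A'.fibre s).toAbelianVariety.dim :=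
  AbelianVarieties.finrank_cechH1_structureSheaf_eq_dim_of_charZero (A'.fibre s).toAbelianVariety U hU hUcov

/-- The underlying space of `A′ ×_{S′} Spec K` (in the `Over S′`-spelling) is quasi-compact. [folklore] -/
private theorem compactSpace_tensor_fibre {S' : Scheme.{0}} (A' : AbelianSchemeOver S') {K : Type} [Field K] (s : Spec (.of K) ⟶ S') :
    CompactSpace ↥(A'.X ⊗ Over.mk s).left := by
  haveI : IsProper (Limits.pullback.snd A'.X.hom s) := MorphismProperty.pullback_snd (P := @IsProper) _ _ A'.isProper
  exact QuasiCompact.compactSpace_of_compactSpace (X := (A'.X ⊗ Over.mk s).left) (Limits.pullback.snd A'.X.hom s)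

/-! ## §2 The target-space panel `E : H¹(X′, 𝓘) ≃+ (Fin g → K)` with scalars -/

/-- **K4 — TARGET SPACE OF THE KODAIRA–SPENCER COUNT** ([MumfordAV1970] §13 pp. 126–127: «… `H¹(𝒪) ⊗ (t₀)` … both have dimension `g`»;
[Hartshorne2010] Thm. 6.4 (b): the torsor group `H¹(J ⊗_C 𝒪_X) = H¹(X₀, 𝒪_{X₀})`).  For the principal small extension `A′_C ⊂ A′_{C′}` of the abelian
scheme `A′ = A.baseChange p` (ideal `𝓘` of the first-order thickening `(A′.X ◁ ι₀).left`), a residue field `π₀ : C′ ↠ K` and `g := dim A′_K`, there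
is an additive isomorphism `E : H¹(A′_{C′}, 𝓘) ≃+ (Fin g → K)` such that EVERY endomorphism `μ` of `𝓘` acting sectionwise as multiplication by the
global function `c ∈ C′` acts through `E` as the scalar `π₀ c`: `E (H¹(μ) t) = π₀ c • E t`.  (`E = ℓ ∘ e₂ ∘ e₁⁻¹`: S-c1 `H¹(X₀, 𝒪) ≃ H¹(𝓘)` with
scalars, S-c2 `H¹(X₀, 𝒪) ≃ Ȟ¹(𝔘, 𝒪)` with scalars on a finite affine cover, (H1′) `dim_K Ȟ¹ = g`, a `K`-basis `ℓ`.)  Consumed as `(E, hdim := rfl)`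
by `PoincareFamilyKSAssembly.exists_lift_detClassH_eq_add_of_count` in the S-e closer, the scalar clause feeding its `hsmul` through K3.
[cite: MumfordAV1970, §13 (proof of the Theorem, pp. 126–127) and Cor. 2 (p. 129)] [cite: Hartshorne2010, §6 (6.1) pp. 46–47 and Thm. 6.4 (b) (pp. 50–51)]
[cite: Hartshorne1977, III Thm. 4.5 (p. 222)] -/
theorem exists_addEquiv_idealCohomology_pi_smallExtension :
    ∀ (R : Type) [CommRing R] [IsNoetherianRing R] [Algebra ℚ R] (A : AbelianSchemeOver (Spec (.of R)))
    {S' : Scheme.{0}} [IsAffine S'] (p : S' ⟶ Spec (.of R)) [IsFinite p] [Etale p] [Surjective p]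
    (C' C K : Type) [CommRing C'] [IsLocalRing C'] [IsArtinianRing C'] [CommRing C] [Field K]
    (q : C' →+* C) (_hq : Function.Surjective q) (t₀ : C') (_hker : RingHom.ker q = Ideal.span {t₀})
    (_htm : ∀ m ∈ IsLocalRing.maximalIdeal C', t₀ * m = 0) (_ht₀ : t₀ ≠ 0)
    (π₀ : C' →+* K) (_hπ₀ : Function.Surjective π₀) (_hkπ : RingHom.ker π₀ = IsLocalRing.maximalIdeal C')
    (c' : Spec (.of C') ⟶ S')
    (ι₀ : Over.mk (Spec.map (CommRingCat.ofHom q) ≫ c') ⟶ Over.mk c') (_hι : ι₀.left = Spec.map (CommRingCat.ofHom q))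
    (g : ℕ) (_hg : ((A.baseChange p).fibre (Spec.map (CommRingCat.ofHom π₀) ≫ c')).toAbelianVariety.dim = g),
    ∃ E : (idealSheafAb ((A.baseChange p).X ◁ ι₀).left).H 1 ≃+ (Fin g → K),
      ∀ (c : C') (μ : idealSheafAb ((A.baseChange p).X ◁ ι₀).left ⟶ idealSheafAb ((A.baseChange p).X ◁ ι₀).left),
        (∀ (V : ((A.baseChange p).X ⊗ Over.mk c').left.Opens) (x : (idealSheafAb ((A.baseChange p).X ◁ ι₀).left).obj.obj (op V)),
          idealVal ((A.baseChange p).X ◁ ι₀).left V (μ.hom.app (op V) x) =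
            ((A.baseChange p).X ⊗ Over.mk c').left.presheaf.map (homOfLE le_top).op
              (specStructureMap (Limits.pullback.snd (A.baseChange p).X.hom c') c) *
              idealVal ((A.baseChange p).X ◁ ι₀).left V x) →
        ∀ t : (idealSheafAb ((A.baseChange p).X ◁ ι₀).left).H 1, E (Sheaf.H.map μ 1 t) = π₀ c • E t := by
  intro R _ _ _ A S' _ p _ _ _ C' C K _ _ _ _ _ q hq t₀ hker htm ht₀ π₀ hπ₀ hkπ c' ι₀ hι g hg
  -- the closed fibre `X₀ = A′_K ↪ X′` over `S′`
  have hικ₀ : ∃ ικ : Over.mk (Spec.map (CommRingCat.ofHom π₀) ≫ c') ⟶ Over.mk c',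
      ικ.left = Spec.map (CommRingCat.ofHom π₀) := ⟨Over.homMk (Spec.map (CommRingCat.ofHom π₀)) rfl, rfl⟩
  obtain ⟨ικ, hικ⟩ := hικ₀
  -- (S-c1) `e₁ : H¹(X₀, 𝒪) ≃+ H¹(X′, 𝓘)` with scalars
  have hSc1 := exists_structureSheafCohomology_addEquiv_idealCohomology_smallExtension R A p C' C K q hq t₀ hker
    htm ht₀ π₀ hπ₀ hkπ c' ι₀ hι ικ hικ
  obtain ⟨e₁, hsc₁, -⟩ := hSc1
  -- a finite affine open cover `𝔘` of `X₀`
  haveI := compactSpace_tensor_fibre (A.baseChange p) (Spec.map (CommRingCat.ofHom π₀) ≫ c')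
  have hcov := exists_finite_isAffineOpen_cover ((A.baseChange p).X ⊗ Over.mk (Spec.map (CommRingCat.ofHom π₀) ≫ c')).left
  obtain ⟨ι, _, U, hUaff, hUcov⟩ := hcov
  -- (S-c2) `e₂ : H¹(X₀, 𝒪) ≃+ Ȟ¹(𝔘, 𝒪_{X₀})` with scalars (structure map `f₀ = pr₂ : X₀ → Spec K`)
  have hSc2 := Motives.exists_addEquiv_structureSheafCohomology_cechH1
    (X := ((A.baseChange p).X ⊗ Over.mk (Spec.map (CommRingCat.ofHom π₀) ≫ c')).left)
    (Limits.pullback.snd (A.baseChange p).X.hom (Spec.map (CommRingCat.ofHom π₀) ≫ c')) U hUaff hUcov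
  obtain ⟨e₂, -, hsc₂⟩ := hSc2
  -- (H1′) `dim_K Ȟ¹(𝔘, 𝒪_{X₀}) = dim A′_K = g` (characteristic `0`: `ℚ → R → Γ(Spec C′) → K`)
  haveI : CharZero K := charZero_of_ringHom_of_algebraRat
    (π₀.comp ((Scheme.ΓSpecIso (.of C')).hom.hom.comp (specStructureMap (c' ≫ p))))
  have hH1 := finite_finrank_cechH1_tensor_fibre (A.baseChange p) (Spec.map (CommRingCat.ofHom π₀) ≫ c') U hUaff hUcov
  obtain ⟨hfin, hrk⟩ := hH1
  haveI := hfin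
  -- a `K`-basis of `Ȟ¹`: `ℓ : Ȟ¹(𝔘, 𝒪_{X₀}) ≃ₗ[K] (Fin g → K)`
  let ℓ : CechH1 (X := ((A.baseChange p).X ⊗ Over.mk (Spec.map (CommRingCat.ofHom π₀) ≫ c')).left)
      (Limits.pullback.snd (A.baseChange p).X.hom (Spec.map (CommRingCat.ofHom π₀) ≫ c')) U ≃ₗ[K] (Fin g → K) :=
    (Module.finBasisOfFinrankEq K _ (hrk.trans hg)).equivFun
  refine ⟨(e₁.symm.trans e₂).trans ℓ.toAddEquiv, fun c μ hμ t => ?_⟩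
  -- the endomorphism `ν` of `𝒪_{X₀}` matching `μ` (S-c2 §4: multiplication by the global function `f₀♯(π₀ c)`)
  have hν₀ := Motives.exists_structureSheafAb_hom_mul
    (X := ((A.baseChange p).X ⊗ Over.mk (Spec.map (CommRingCat.ofHom π₀) ≫ c')).left)
    (specStructureMap (Limits.pullback.snd (A.baseChange p).X.hom (Spec.map (CommRingCat.ofHom π₀) ≫ c')) (π₀ c))
  obtain ⟨ν, hν⟩ := hν₀
  have hν' : ∀ (W : ((A.baseChange p).X ⊗ Over.mk (Spec.map (CommRingCat.ofHom π₀) ≫ c')).left.Opens)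
      (y : Γ(((A.baseChange p).X ⊗ Over.mk (Spec.map (CommRingCat.ofHom π₀) ≫ c')).left, W)),
      ((ν.hom.app (op W)) y : Γ(((A.baseChange p).X ⊗ Over.mk (Spec.map (CommRingCat.ofHom π₀) ≫ c')).left, W)) =
        (((A.baseChange p).X ⊗ Over.mk (Spec.map (CommRingCat.ofHom π₀) ≫ c')).left.presheaf.map (homOfLE (le_top : W ≤ ⊤)).op
          (specStructureMap (Limits.pullback.snd (A.baseChange p).X.hom (Spec.map (CommRingCat.ofHom π₀) ≫ c')) (π₀ c)) :
          Γ(((A.baseChange p).X ⊗ Over.mk (Spec.map (CommRingCat.ofHom π₀) ≫ c')).left, W)) * y := hν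
  have key := hsc₁ c μ ν hμ hν' (e₁.symm t)
  -- no `rw` at the level of `Sheaf.H` terms (failing defeq probes between the two cohomology groups are expensive): explicit chains
  have h₁ : e₁.symm (Sheaf.H.map μ 1 t) = Sheaf.H.map ν 1 (e₁.symm t) :=
    e₁.injective (((e₁.apply_symm_apply _).trans
      (congrArg (Sheaf.H.map μ 1) (e₁.apply_symm_apply t)).symm).trans key.symm)
  have h₂ : e₂ (Sheaf.H.map ν 1 (e₁.symm t)) = π₀ c • e₂ (e₁.symm t) :=
    hsc₂ (π₀ c) ν (fun V x => by rw [Sections.algebraMap_apply]; exact hν V x) _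
  calc ((e₁.symm.trans e₂).trans ℓ.toAddEquiv) (Sheaf.H.map μ 1 t) = ℓ (e₂ (e₁.symm (Sheaf.H.map μ 1 t))) := rfl
    _ = ℓ (e₂ (Sheaf.H.map ν 1 (e₁.symm t))) := congrArg (fun z => ℓ (e₂ z)) h₁
    _ = ℓ (π₀ c • e₂ (e₁.symm t)) := congrArg ℓ h₂
    _ = π₀ c • ℓ (e₂ (e₁.symm t)) := ℓ.map_smul _ _
    _ = π₀ c • ((e₁.symm.trans e₂).trans ℓ.toAddEquiv) t := rfl

/-- **K4 in the S-e closer's socket form** (F0P1c-p01 (g0) SOCKETS v0 §4): the same panel with the dimension hypothesis stated as the RELATIVE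
DIMENSION of the closed fibre, `hg : (A′.baseChange s_K).IsOfRelDim g` (★ `exists_isOfRelDim` over the connected `Spec K`), instead of `dim A′_K = g` —
the two agree by uniqueness of the relative dimension of a smooth morphism with non-empty source (★ `AbelianScheme.isOfRelDim_dim`, ★
`Motives.AbelianVarietyProofs.eq_of_smoothOfRelativeDimension`; `(A′.fibre s).toOver = A′.baseChange s` on the nose).
[cite: MumfordAV1970, §13 (proof of the Theorem, pp. 126–127) and Cor. 2 (p. 129)] [cite: GortzWedhorn2020, Remark 16.54] -/
theorem exists_addEquiv_idealCohomology_pi_smallExtension_of_isOfRelDim :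
    ∀ (R : Type) [CommRing R] [IsNoetherianRing R] [Algebra ℚ R] (A : AbelianSchemeOver (Spec (.of R)))
    {S' : Scheme.{0}} [IsAffine S'] (p : S' ⟶ Spec (.of R)) [IsFinite p] [Etale p] [Surjective p]
    (C' C K : Type) [CommRing C'] [IsLocalRing C'] [IsArtinianRing C'] [CommRing C] [Field K]
    (q : C' →+* C) (_hq : Function.Surjective q) (t₀ : C') (_hker : RingHom.ker q = Ideal.span {t₀})
    (_htm : ∀ m ∈ IsLocalRing.maximalIdeal C', t₀ * m = 0) (_ht₀ : t₀ ≠ 0)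
    (π₀ : C' →+* K) (_hπ₀ : Function.Surjective π₀) (_hkπ : RingHom.ker π₀ = IsLocalRing.maximalIdeal C')
    (c' : Spec (.of C') ⟶ S')
    (ι₀ : Over.mk (Spec.map (CommRingCat.ofHom q) ≫ c') ⟶ Over.mk c') (_hι : ι₀.left = Spec.map (CommRingCat.ofHom q))
    (g : ℕ) (_hg : ((A.baseChange p).baseChange (Spec.map (CommRingCat.ofHom π₀) ≫ c')).IsOfRelDim g),
    ∃ E : (idealSheafAb ((A.baseChange p).X ◁ ι₀).left).H 1 ≃+ (Fin g → K),
      ∀ (c : C') (μ : idealSheafAb ((A.baseChange p).X ◁ ι₀).left ⟶ idealSheafAb ((A.baseChange p).X ◁ ι₀).left),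
        (∀ (V : ((A.baseChange p).X ⊗ Over.mk c').left.Opens) (x : (idealSheafAb ((A.baseChange p).X ◁ ι₀).left).obj.obj (op V)),
          idealVal ((A.baseChange p).X ◁ ι₀).left V (μ.hom.app (op V) x) =
            ((A.baseChange p).X ⊗ Over.mk c').left.presheaf.map (homOfLE le_top).op
              (specStructureMap (Limits.pullback.snd (A.baseChange p).X.hom c') c) *
              idealVal ((A.baseChange p).X ◁ ι₀).left V x) →
        ∀ t : (idealSheafAb ((A.baseChange p).X ◁ ι₀).left).H 1, E (Sheaf.H.map μ 1 t) = π₀ c • E t := by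
  intro R _ _ _ A S' _ p _ _ _ C' C K _ _ _ _ _ q hq t₀ hker htm ht₀ π₀ hπ₀ hkπ c' ι₀ hι g hg
  -- `dim A′_K = g` by uniqueness of the relative dimension (the fibre over the origin is non-empty)
  have h₁ : SmoothOfRelativeDimension g ((A.baseChange p).fibre (Spec.map (CommRingCat.ofHom π₀) ≫ c')).X.hom := hg
  have h₂ : SmoothOfRelativeDimension ((A.baseChange p).fibre (Spec.map (CommRingCat.ofHom π₀) ≫ c')).toAbelianVariety.dim
      ((A.baseChange p).fibre (Spec.map (CommRingCat.ofHom π₀) ≫ c')).X.hom :=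
    ((A.baseChange p).fibre (Spec.map (CommRingCat.ofHom π₀) ≫ c')).isOfRelDim_dim
  haveI : Nonempty ((A.baseChange p).fibre (Spec.map (CommRingCat.ofHom π₀) ≫ c')).X.left :=
    ⟨Motives.AbelianVariety.origin ((A.baseChange p).fibre (Spec.map (CommRingCat.ofHom π₀) ≫ c')).toAbelianVariety⟩
  have hdim : ((A.baseChange p).fibre (Spec.map (CommRingCat.ofHom π₀) ≫ c')).toAbelianVariety.dim = g :=
    Motives.AbelianVarietyProofs.eq_of_smoothOfRelativeDimension _ h₂ h₁
  exact exists_addEquiv_idealCohomology_pi_smallExtension R A p C' C K q hq t₀ hker htm ht₀ π₀ hπ₀ hkπ c' ι₀ hι g hdim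

/-! ## §3 The S-e closer's sockets, on the nose (F0P1c-p01 (g0) skeleton v0 2d636334 `socket_p05` ∕ `socket_p05mu`) -/

/-- **SOCKET `socket_p05` of the S-e closer, token for token**: the panel of §2 at the residue field `κ = C′/𝔪` (`π₀ := IsLocalRing.residue C′`),
with the closer's (unused here) extra binders `[IsLocalRing C] [IsArtinianRing C] [IsFirstOrderThickening …]`.
[cite: MumfordAV1970, §13 (proof of the Theorem, pp. 126–127) and Cor. 2 (p. 129)] [cite: Hartshorne2010, §6 (6.1) pp. 46–47 and Thm. 6.4 (b) (pp. 50–51)] -/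
theorem exists_addEquiv_idealCohomology_pi_residueField_smallExtension :
    ∀ (R : Type) [CommRing R] [IsNoetherianRing R] [Algebra ℚ R] (A : AbelianSchemeOver (Spec (.of R)))
    {S' : Scheme.{0}} [IsAffine S'] (p : S' ⟶ Spec (.of R)) [IsFinite p] [Etale p] [Surjective p]
    (C' C : Type) [CommRing C'] [IsLocalRing C'] [IsArtinianRing C'] [CommRing C] [IsLocalRing C] [IsArtinianRing C]
    (q : C' →+* C) (_hq : Function.Surjective q) (t₀ : C') (_hker₀ : RingHom.ker q = Ideal.span {t₀})
    (_htm : ∀ m ∈ IsLocalRing.maximalIdeal C', t₀ * m = 0) (_ht₀ : t₀ ≠ 0)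
    (c' : Spec (.of C') ⟶ S')
    (ι₀ : Over.mk (Spec.map (CommRingCat.ofHom q) ≫ c') ⟶ Over.mk c') (_hι : ι₀.left = Spec.map (CommRingCat.ofHom q))
    [IsFirstOrderThickening ((A.baseChange p).X ◁ ι₀).left]
    (g : ℕ) (_hg : ((A.baseChange p).baseChange (Spec.map (CommRingCat.ofHom (IsLocalRing.residue C')) ≫ c')).IsOfRelDim g),
    ∃ E : (idealSheafAb ((A.baseChange p).X ◁ ι₀).left).H 1 ≃+ (Fin g → IsLocalRing.ResidueField C'),
      ∀ (c : C') (mu : idealSheafAb ((A.baseChange p).X ◁ ι₀).left ⟶ idealSheafAb ((A.baseChange p).X ◁ ι₀).left),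
        (∀ (U : ((A.baseChange p).X ⊗ Over.mk c').left.Opens) (y : (idealSheafAb ((A.baseChange p).X ◁ ι₀).left).obj.obj (op U)),
          idealVal ((A.baseChange p).X ◁ ι₀).left U (mu.hom.app (op U) y) =
            ((A.baseChange p).X ⊗ Over.mk c').left.presheaf.map (homOfLE le_top).op
              (specStructureMap (pullback.snd (A.baseChange p).X.hom c') c) * idealVal ((A.baseChange p).X ◁ ι₀).left U y) →
        ∀ t, E (Sheaf.H.map mu 1 t) = IsLocalRing.residue C' c • E t := by
  intro R _ _ _ A S' _ p _ _ _ C' C _ _ _ _ _ _ q hq t₀ hker htm ht₀ c' ι₀ hι _ g hg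
  exact exists_addEquiv_idealCohomology_pi_smallExtension_of_isOfRelDim R A p C' C (IsLocalRing.ResidueField C') q hq t₀ hker
    htm ht₀ (IsLocalRing.residue C') IsLocalRing.residue_surjective IsLocalRing.ker_residue c' ι₀ hι g hg

/-- **SOCKET `socket_p05mu` of the S-e closer, token for token**: for any `X : Over S′` and `c ∈ C′`, the endomorphism of `𝓘` acting sectionwise as
multiplication by the global function `c` EXISTS (★ `Deformation.exists_idealSheafAb_hom_mul`, p792075, at `s := pr₂♯ c`).
[cite: GortzWedhorn2020, Section (7.3) eq. (7.3.6)] -/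
theorem exists_idealSheafAb_hom_mul_specStructureMap {S' : Scheme.{0}} (X : Over S') {C' C : Type} [CommRing C'] [CommRing C]
    (q : C' →+* C) (c' : Spec (.of C') ⟶ S')
    (ι₀ : Over.mk (Spec.map (CommRingCat.ofHom q) ≫ c') ⟶ Over.mk c') (c : C') :
    ∃ mu : idealSheafAb (X ◁ ι₀).left ⟶ idealSheafAb (X ◁ ι₀).left,
      ∀ (U : (X ⊗ Over.mk c').left.Opens) (y : (idealSheafAb (X ◁ ι₀).left).obj.obj (op U)),
        idealVal (X ◁ ι₀).left U (mu.hom.app (op U) y) =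
          (X ⊗ Over.mk c').left.presheaf.map (homOfLE le_top).op (specStructureMap (pullback.snd X.hom c') c) *
            idealVal (X ◁ ι₀).left U y :=
  Literature.AlgebraicGeometry.Deformation.exists_idealSheafAb_hom_mul (X ◁ ι₀).left (specStructureMap (pullback.snd X.hom c') c)

end AbelianSchemeOver

end Literature.AlgebraicGeometry.AbelianSchemes

end
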